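import Mathlib.Analysis.Normed.Unbundled.SpectralNorm
import Mathlib.Analysis.Normed.Module.FiniteDimension
import Literature.NumberTheory.GaloisRepresentations.PadicAlgebraIntegral
import Mathlib.NumberTheory.Padics.ProperSpace
import HarnessLib

/-!
# Rigidity of `ℚ_p` inside finite extensions of `ℚ_q` ([AbsTopIII] Rmk. 1.5.4 (iii), tools)

Proof-only tools (no new definitions; Mathlib-only) for the second half of
S. Mochizuki, *Topics in Absolute Anabelian Geometry III*, §1, Rmk. 1.5.4 (iii), manuscript p. 34
(lit key `paper:url-5493eb38cbb7`): "if [...] `I` is an infinite set, then the field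
`k := ℚ_p(x_i)_{i ∈ I}` [...] constitutes an example of a Kummer-faithful field which is not
sub-`p`-adic" — where "sub-`p`-adic" ([Mzk5] Def. 15.4 (i)) allows an ABSTRACT field embedding into
a finitely generated extension of SOME `ℚ_q`.  Controlling such abstract embeddings rests on the
following classical rigidity facts, kernel-checked here:

* `Padic.exists_pow_eq_of_norm_sub_one_lt` : a principal unit `u ∈ 1 + pℤ_p` is an `N`-th power
  in `ℚ_p` for every `N` prime to `p` (Hensel's lemma for `X^N − u`);
* `exists_spectralNorm_pow_factorial_eq_zpow`,
  `spectralNorm_eq_one_of_forall_exists_pow_prime_pow_eq` : in a finite extension `F` of `ℚ_q`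
  (spectral norm), `‖z‖^{[F:ℚ_q]!} ∈ q^ℤ`, so an element with `ℓ^n`-th roots for all `n` has
  norm `1`;
* `padicRingHom_eq_algebraMap` : RIGIDITY — every ring homomorphism `ψ : ℚ_p → F` into a finite
  extension `F` of `ℚ_p` is the structure map (`ψ` is bounded on `ℤ_p` by the two facts above,
  hence continuous, and agrees with `algebraMap` on the dense subfield `ℚ`).  This is the
  ABSTRACT-BINDER form (`[Algebra ℚ_[p] F] [FiniteDimensional ℚ_[p] F]`, no valuation or topology
  on `F`, as in `MLFGaloisGroups.lean`) of the tree's local-field statement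
  `Literature.NumberTheory.GaloisRepresentations.LocalField.ringHom_padic_ext` (which assumes
  `[IsNonarchimedeanLocalField K]`); the proof here uses only the spectral norm;
* `not_dvd_of_padicRingHom` : no ring homomorphism `ℚ_p → F` exists when `F` is a finite
  extension of `ℚ_q` with `q ≠ p` (the integer `1 + p·j ≡ 0 (mod q)` would be
  `ℓ^∞`-divisible in `F` yet of `q`-adic norm `< 1`).

HONEST FRAMING: classical facts about `p`-adic fields; nothing here bears on [IUTchIII]
Cor. 3.12. [cite: MochizukiAbsTopIII2015, Rmk 1.5.4 (iii) p.34]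
-/

noncomputable section

open scoped Classical

namespace Literature.AnabelianGeometry.AbsoluteAnabelian.AbsTopIII

/-! ## Principal units of `ℚ_p` are `N`-th powers for `N` prime to `p` -/

/-- If `‖u − 1‖_p < 1` and `p ∤ N`, then `u = y^N` for some `y ∈ ℚ_p` — the `ℚ_p`-form of the
tree's `LocalField.PadicInt.exists_pow_eq_of_norm_sub_one_lt` (Hensel's lemma for `X^N − u` at the
simple root `1`; the divisibility of `1 + pℤ_p` used in [AbsTopIII] Rmk. 1.5.3 (i) / 1.5.4 (iii)).
[cite: MochizukiAbsTopIII2015, Rmk 1.5.4 (iii) p.34] -/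
theorem Padic.exists_pow_eq_of_norm_sub_one_lt {p : ℕ} [Fact p.Prime] {u : ℚ_[p]}
    (hu : ‖u - 1‖ < 1) {N : ℕ} (hN : ¬ p ∣ N) : ∃ y : ℚ_[p], y ^ N = u := by
  -- `u` is a `p`-adic integer
  have hu1 : ‖u‖ ≤ 1 := by
    have : u = (u - 1) + 1 := by ring
    rw [this]
    exact (Padic.nonarchimedean _ _).trans (max_le hu.le (by simp))
  set u' : ℤ_[p] := ⟨u, hu1⟩ with hu'
  have hu'1 : ‖u' - 1‖ < 1 := by simpa [PadicInt.norm_def, hu'] using hu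
  obtain ⟨z, hz⟩ :=
    Literature.NumberTheory.GaloisRepresentations.LocalField.PadicInt.exists_pow_eq_of_norm_sub_one_lt
      ((Nat.Prime.coprime_iff_not_dvd Fact.out).mpr hN) hu'1
  refine ⟨(z : ℚ_[p]), ?_⟩
  have := congrArg ((↑) : ℤ_[p] → ℚ_[p]) hz
  simpa [hu'] using this

/-- In particular every `u ∈ ℚ_p` with `‖u − 1‖_p < 1` has `ℓ^n`-th roots for all `n`, for any
prime `ℓ ≠ p`. [cite: MochizukiAbsTopIII2015, Rmk 1.5.4 (iii) p.34] -/
theorem Padic.exists_pow_prime_pow_eq_of_norm_sub_one_lt {p : ℕ} [Fact p.Prime] {u : ℚ_[p]}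
    (hu : ‖u - 1‖ < 1) {ℓ : ℕ} (hℓ : ℓ.Prime) (hℓp : ℓ ≠ p) (n : ℕ) :
    ∃ y : ℚ_[p], y ^ (ℓ ^ n) = u := by
  refine Padic.exists_pow_eq_of_norm_sub_one_lt hu fun h => hℓp ?_
  exact ((Nat.prime_dvd_prime_iff_eq Fact.out hℓ).mp ((Fact.out : p.Prime).dvd_of_dvd_pow h)).symm

/-- There is a prime different from `p` (e.g. `2` or `3`). [cite: MochizukiAbsTopIII2015, Rmk 1.5.4 (iii) p.34] -/
theorem exists_prime_ne (p : ℕ) : ∃ ℓ : ℕ, ℓ.Prime ∧ ℓ ≠ p := by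
  by_cases h : p = 2
  · exact ⟨3, Nat.prime_three, by omega⟩
  · exact ⟨2, Nat.prime_two, fun h' => h h'.symm⟩

/-! ## The value group of a finite extension of `ℚ_q` (spectral norm) is discrete -/

section Spectral

variable (q : ℕ) [Fact q.Prime] (F : Type*) [Field F] [Algebra ℚ_[q] F] [FiniteDimensional ℚ_[q] F]

include q in
/-- For `z ≠ 0` in a finite extension `F/ℚ_q`, `‖z‖_sp ^ ([F:ℚ_q]!) = q^m` for some integer `m`
(`‖z‖_sp = ‖a₀‖_q^{1/deg}`, `a₀` the constant coefficient of the minimal polynomial of `z`).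
[cite: MochizukiAbsTopIII2015, Rmk 1.5.4 (iii) p.34] -/
theorem exists_spectralNorm_pow_factorial_eq_zpow (z : F) (hz : z ≠ 0) :
    ∃ m : ℤ, spectralNorm ℚ_[q] F z ^ (Module.finrank ℚ_[q] F).factorial = (q : ℝ) ^ m := by
  haveI : Algebra.IsAlgebraic ℚ_[q] F := Algebra.IsAlgebraic.of_finite ℚ_[q] F
  have hint : IsIntegral ℚ_[q] z := Algebra.IsIntegral.isIntegral z
  have hdpos : 0 < (minpoly ℚ_[q] z).natDegree := minpoly.natDegree_pos hint
  have hdle : (minpoly ℚ_[q] z).natDegree ≤ Module.finrank ℚ_[q] F := minpoly.natDegree_le z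
  obtain ⟨r, hr⟩ := Nat.dvd_factorial hdpos hdle
  have ha0 : (minpoly ℚ_[q] z).coeff 0 ≠ 0 := minpoly.coeff_zero_ne_zero hint hz
  have hnorm : spectralNorm ℚ_[q] F z ^ (minpoly ℚ_[q] z).natDegree =
      ‖(minpoly ℚ_[q] z).coeff 0‖ := by
    rw [spectralNorm.spectralNorm_eq_norm_coeff_zero_rpow ℚ_[q] F z, one_div,
      Real.rpow_inv_natCast_pow (norm_nonneg _) hdpos.ne']
  refine ⟨-((minpoly ℚ_[q] z).coeff 0).valuation * r, ?_⟩
  rw [hr, pow_mul, hnorm, Padic.norm_eq_zpow_neg_valuation ha0, ← zpow_natCast, ← zpow_mul]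

include q in
/-- In a finite extension `F/ℚ_q`, a nonzero element admitting `ℓ^n`-th roots for every `n`
(`ℓ` a prime) has spectral norm `1`. [cite: MochizukiAbsTopIII2015, Rmk 1.5.4 (iii) p.34] -/
theorem spectralNorm_eq_one_of_forall_exists_pow_prime_pow_eq {ℓ : ℕ} (hℓ : ℓ.Prime) (x : F)
    (hx : x ≠ 0) (hdiv : ∀ n : ℕ, ∃ y : F, y ^ (ℓ ^ n) = x) : spectralNorm ℚ_[q] F x = 1 := by
  haveI : Algebra.IsAlgebraic ℚ_[q] F := Algebra.IsAlgebraic.of_finite ℚ_[q] F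
  have hD : (Module.finrank ℚ_[q] F).factorial ≠ 0 := Nat.factorial_ne_zero _
  obtain ⟨m, hm⟩ := exists_spectralNorm_pow_factorial_eq_zpow q F x hx
  have hq1 : (1 : ℝ) < q := by exact_mod_cast (Fact.out : q.Prime).one_lt
  have hq0 : (0 : ℝ) < q := lt_trans zero_lt_one hq1
  -- every power of `ℓ` divides `m`
  have hdvd : ∀ n : ℕ, ((ℓ ^ n : ℕ) : ℤ) ∣ m := by
    intro n
    obtain ⟨y, hy⟩ := hdiv n
    have hN : 0 < ℓ ^ n := pow_pos hℓ.pos n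
    have hy0 : y ≠ 0 := by
      rintro rfl
      rw [zero_pow hN.ne'] at hy
      exact hx hy.symm
    obtain ⟨m', hm'⟩ := exists_spectralNorm_pow_factorial_eq_zpow q F y hy0
    have key : (q : ℝ) ^ m = (q : ℝ) ^ (m' * (ℓ ^ n : ℕ)) := by
      rw [← hm, ← hy, isPowMul_spectralNorm y hN, ← pow_mul, mul_comm (ℓ ^ n), pow_mul, hm',
        ← zpow_natCast, ← zpow_mul]
    exact ⟨m', by rw [zpow_right_injective₀ hq0 hq1.ne' key, mul_comm]⟩
  have hm0 : m = 0 := by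
    refine Int.eq_zero_of_dvd_of_natAbs_lt_natAbs (hdvd m.natAbs) ?_
    rw [Int.natAbs_natCast]
    exact Nat.lt_pow_self hℓ.one_lt
  rw [hm0, zpow_zero] at hm
  exact (pow_left_inj₀ (spectralNorm_nonneg x) zero_le_one hD).mp (by rw [hm, one_pow])

end Spectral

/-! ## Rigidity: ring homomorphisms `ℚ_p → F`, `F/ℚ_q` finite -/

section Rigidity

variable {p : ℕ} [Fact p.Prime] {F : Type*} [Field F]

/-- No ring homomorphism `ℚ_p → F` into a finite extension `F` of `ℚ_q` with `q ≠ p`: the integer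
`a = 1 + p·j` with `q ∣ a` lies in `1 + pℤ_p`, hence is `ℓ^∞`-divisible in `ℚ_p` (`ℓ ∉ {p}`),
so its image has spectral norm `1` — but `‖a‖_q < 1`.
[cite: MochizukiAbsTopIII2015, Rmk 1.5.4 (iii) p.34] -/
theorem eq_of_padicRingHom {q : ℕ} [Fact q.Prime] [Algebra ℚ_[q] F] [FiniteDimensional ℚ_[q] F]
    (ψ : ℚ_[p] →+* F) : q = p := by
  haveI : Algebra.IsAlgebraic ℚ_[q] F := Algebra.IsAlgebraic.of_finite ℚ_[q] F
  by_contra hqp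
  have hp : p.Prime := Fact.out
  have hq : q.Prime := Fact.out
  -- an integer `a = 1 + p * j` divisible by `q`
  obtain ⟨j, hj⟩ : ∃ j : ℕ, q ∣ 1 + p * j := by
    have hcop : Nat.Coprime p q := (Nat.coprime_primes hp hq).mpr (Ne.symm hqp)
    obtain ⟨c, -, hc⟩ := Nat.exists_mul_mod_eq_one_of_coprime hcop hq.one_lt
    -- `p * c ≡ 1 (mod q)`; take `j = c * (q - 1)` so that `1 + p j ≡ 1 + (q-1) ≡ 0`.
    refine ⟨c * (q - 1), ?_⟩
    have h1 : p * c ≡ 1 [MOD q] := by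
      rw [Nat.ModEq, hc, Nat.mod_eq_of_lt hq.one_lt]
    have h2 : 1 + p * (c * (q - 1)) ≡ 1 + 1 * (q - 1) [MOD q] := by
      rw [← mul_assoc]
      exact Nat.ModEq.add_left 1 (Nat.ModEq.mul_right (q - 1) h1)
    have h3 : 1 + 1 * (q - 1) = q := by have := hq.one_lt; omega
    rw [h3] at h2
    exact Nat.modEq_zero_iff_dvd.mp (h2.trans (Nat.modEq_zero_iff_dvd.mpr dvd_rfl))
  set a : ℕ := 1 + p * j with ha
  -- `a` is `ℓ^∞`-divisible in `ℚ_p` for a prime `ℓ ≠ p`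
  obtain ⟨ℓ, hℓ, hℓp⟩ := exists_prime_ne p
  have hau : ‖(a : ℚ_[p]) - 1‖ < 1 := by
    have : (a : ℚ_[p]) - 1 = (p : ℚ_[p]) * j := by simp [ha]
    rw [this, norm_mul, Padic.norm_p]
    have hj1 : ‖(j : ℚ_[p])‖ ≤ 1 := by exact_mod_cast Padic.norm_int_le_one (j : ℤ)
    calc (p : ℝ)⁻¹ * ‖(j : ℚ_[p])‖ ≤ (p : ℝ)⁻¹ * 1 := by gcongr
      _ < 1 := by
        rw [mul_one]
        exact inv_lt_one_of_one_lt₀ (by exact_mod_cast hp.one_lt)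
  have hdiv : ∀ n : ℕ, ∃ y : F, y ^ (ℓ ^ n) = (a : F) := by
    intro n
    obtain ⟨y, hy⟩ := Padic.exists_pow_prime_pow_eq_of_norm_sub_one_lt hau hℓ hℓp n
    exact ⟨ψ y, by rw [← map_pow, hy, map_natCast]⟩
  have ha0 : (a : F) ≠ 0 := by
    haveI : CharZero F := charZero_of_injective_algebraMap (algebraMap ℚ_[q] F).injective
    exact_mod_cast (show a ≠ 0 by omega)
  have h1 : spectralNorm ℚ_[q] F (a : F) = 1 :=
    spectralNorm_eq_one_of_forall_exists_pow_prime_pow_eq q F hℓ (a : F) ha0 hdiv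
  -- but `‖a‖_q < 1`
  have h2 : spectralNorm ℚ_[q] F (a : F) < 1 := by
    rw [← map_natCast (algebraMap ℚ_[q] F) a, spectralNorm_extends]
    exact Padic.norm_natCast_lt_one_iff.mpr hj
  exact absurd h1 h2.ne

variable [Algebra ℚ_[p] F] [FiniteDimensional ℚ_[p] F]

/-- Boundedness of an abstract ring homomorphism `ψ : ℚ_p → F` (`F/ℚ_p` finite) on `ℤ_p`:
`‖ψ x‖_sp ≤ p` for `‖x‖_p ≤ 1` (since `1 + p x` is `ℓ^∞`-divisible, `‖ψ(1 + p x)‖_sp = 1`).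
[cite: MochizukiAbsTopIII2015, Rmk 1.5.4 (iii) p.34] -/
private theorem spectralNorm_padicRingHom_le (ψ : ℚ_[p] →+* F) (x : ℚ_[p]) (hx : ‖x‖ ≤ 1) :
    spectralNorm ℚ_[p] F (ψ x) ≤ p := by
  haveI : Algebra.IsAlgebraic ℚ_[p] F := Algebra.IsAlgebraic.of_finite ℚ_[p] F
  have hp : p.Prime := Fact.out
  letI : NormedField F := spectralNorm.normedField ℚ_[p] F
  have hnorm : ∀ z : F, ‖z‖ = spectralNorm ℚ_[p] F z := fun _ => rfl
  haveI : IsUltrametricDist F :=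
    IsUltrametricDist.isUltrametricDist_of_forall_norm_add_le_max_norm
      (fun a b => isNonarchimedean_spectralNorm a b)
  obtain ⟨ℓ, hℓ, hℓp⟩ := exists_prime_ne p
  set u : ℚ_[p] := 1 + p * x with hu
  have hu1 : ‖u - 1‖ < 1 := by
    rw [hu, add_sub_cancel_left, norm_mul, Padic.norm_p]
    calc (p : ℝ)⁻¹ * ‖x‖ ≤ (p : ℝ)⁻¹ * 1 := by gcongr
      _ < 1 := by rw [mul_one]; exact inv_lt_one_of_one_lt₀ (by exact_mod_cast hp.one_lt)
  have hu0 : u ≠ 0 := by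
    intro h
    rw [h, zero_sub, norm_neg, norm_one] at hu1
    exact lt_irrefl _ hu1
  have hψu : spectralNorm ℚ_[p] F (ψ u) = 1 := by
    refine spectralNorm_eq_one_of_forall_exists_pow_prime_pow_eq p F hℓ (ψ u)
      ((map_ne_zero ψ).mpr hu0) fun n => ?_
    obtain ⟨y, hy⟩ := Padic.exists_pow_prime_pow_eq_of_norm_sub_one_lt hu1 hℓ hℓp n
    exact ⟨ψ y, by rw [← map_pow, hy]⟩
  -- `ψ p = p`, of norm `p⁻¹`
  have hψp : ‖ψ (p : ℚ_[p])‖ = (p : ℝ)⁻¹ := by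
    rw [map_natCast, hnorm, ← map_natCast (algebraMap ℚ_[p] F) p, spectralNorm_extends,
      Padic.norm_p]
  have hpx : ‖ψ (p : ℚ_[p])‖ * ‖ψ x‖ ≤ 1 := by
    rw [← norm_mul, ← map_mul]
    have : (p : ℚ_[p]) * x = u + (-1) := by rw [hu]; ring
    rw [this, map_add, map_neg, map_one]
    refine (IsUltrametricDist.norm_add_le_max _ _).trans (max_le ?_ (by simp))
    rw [hnorm, hψu]
  rw [hψp] at hpx
  rw [← hnorm]
  have hp0 : (0 : ℝ) < p := by exact_mod_cast hp.pos
  calc ‖ψ x‖ = p * ((p : ℝ)⁻¹ * ‖ψ x‖) := by field_simp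
    _ ≤ p * 1 := by gcongr
    _ = p := mul_one _

/-- RIGIDITY of `ℚ_p` ([AbsTopIII] Rmk. 1.5.4 (iii), key step): every ring homomorphism
`ψ : ℚ_p → F` into a finite extension `F` of `ℚ_p` coincides with the structure map
`algebraMap ℚ_p F` — `ψ` is bounded on `ℤ_p`, hence continuous for the `p`-adic topology and the
spectral norm on `F`, and agrees with `algebraMap` on the dense subfield `ℚ`.
[cite: MochizukiAbsTopIII2015, Rmk 1.5.4 (iii) p.34] -/
theorem padicRingHom_eq_algebraMap (ψ : ℚ_[p] →+* F) : ψ = algebraMap ℚ_[p] F := by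
  haveI : Algebra.IsAlgebraic ℚ_[p] F := Algebra.IsAlgebraic.of_finite ℚ_[p] F
  have hp : p.Prime := Fact.out
  have hp1 : (1 : ℝ) < p := by exact_mod_cast hp.one_lt
  have hp0 : (0 : ℝ) < p := lt_trans zero_lt_one hp1
  letI : NormedField F := spectralNorm.normedField ℚ_[p] F
  have hnorm : ∀ z : F, ‖z‖ = spectralNorm ℚ_[p] F z := fun _ => rfl
  -- `ψ` is continuous: `‖ψ x‖ ≤ p · p^{-k}` whenever `‖x‖ ≤ p^{-k}`
  have hbound : ∀ (k : ℕ) (x : ℚ_[p]), ‖x‖ ≤ (p : ℝ) ^ (-(k : ℤ)) →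
      ‖ψ x‖ ≤ p * (p : ℝ) ^ (-(k : ℤ)) := by
    intro k x hx
    have hpk : ((p : ℚ_[p]) ^ k) ≠ 0 := pow_ne_zero _ (by exact_mod_cast hp.ne_zero)
    set x' := x / (p : ℚ_[p]) ^ k with hx'
    have hxx' : x = (p : ℚ_[p]) ^ k * x' := by rw [hx', mul_div_cancel₀ _ hpk]
    have hx'1 : ‖x'‖ ≤ 1 := by
      rw [hx', norm_div, norm_pow, Padic.norm_p, div_le_one (by positivity), inv_pow,
        ← zpow_natCast, ← zpow_neg]
      exact hx
    have h1 := spectralNorm_padicRingHom_le ψ x' hx'1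
    rw [← hnorm] at h1
    rw [hxx', map_mul, map_pow, norm_mul, norm_pow, map_natCast, hnorm (p : F),
      ← map_natCast (algebraMap ℚ_[p] F) p, spectralNorm_extends, Padic.norm_p, inv_pow,
      ← zpow_natCast, ← zpow_neg, mul_comm]
    gcongr
  have hcont : Continuous ψ := by
    refine continuous_of_continuousAt_zero ψ.toAddMonoidHom ?_
    rw [ContinuousAt, map_zero, Metric.tendsto_nhds_nhds]
    intro ε hε
    obtain ⟨k, hk⟩ : ∃ k : ℕ, p * (p : ℝ) ^ (-(k : ℤ)) < ε := by
      obtain ⟨k, hk⟩ := PadicInt.exists_pow_neg_lt p (div_pos hε hp0)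
      exact ⟨k, by rwa [lt_div_iff₀' hp0] at hk⟩
    refine ⟨(p : ℝ) ^ (-(k : ℤ)), zpow_pos hp0 _, fun x hx => ?_⟩
    rw [dist_zero_right] at hx ⊢
    exact (hbound k x hx.le).trans_lt hk
  have hcont' : Continuous (algebraMap ℚ_[p] F) := by
    refine continuous_of_continuousAt_zero (algebraMap ℚ_[p] F).toAddMonoidHom ?_
    rw [ContinuousAt, map_zero, Metric.tendsto_nhds_nhds]
    intro ε hε
    refine ⟨ε, hε, fun x hx => ?_⟩
    rw [dist_zero_right] at hx ⊢
    change ‖algebraMap ℚ_[p] F x‖ < ε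
    rwa [hnorm, spectralNorm_extends]
  -- both agree on `ℚ`, which is dense
  refine RingHom.ext fun x => ?_
  have heq : (ψ : ℚ_[p] → F) ∘ ((↑) : ℚ → ℚ_[p]) = (algebraMap ℚ_[p] F) ∘ ((↑) : ℚ → ℚ_[p]) := by
    funext r
    simp only [Function.comp_apply, map_ratCast]
  exact congrFun ((Padic.denseRange_ratCast (p := p)).equalizer hcont hcont' heq) x

/-- `ℚ_p` is rigid: its only ring endomorphism is the identity (the case `F = ℚ_p`).
[cite: MochizukiAbsTopIII2015, Rmk 1.5.4 (iii) p.34] -/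
theorem padicRingHom_self_eq_id (ψ : ℚ_[p] →+* ℚ_[p]) : ψ = RingHom.id ℚ_[p] :=
  (padicRingHom_eq_algebraMap (F := ℚ_[p]) ψ).trans (Algebra.algebraMap_self)

end Rigidity

end Literature.AnabelianGeometry.AbsoluteAnabelian.AbsTopIII
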